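import Literature.AlgebraicGeometry.Resolution.FFinite
import Literature.AlgebraicGeometry.Resolution.KunzRegularityCriterionProofs
import Literature.AlgebraicGeometry.Resolution.ResolutionOfSingularities
import Summits.ResolutionOfSingularities.ResolutionOfSingularities.Theorems.FrobeniusLadderFRationalModificationTestElement
import Mathlib.AlgebraicGeometry.Morphisms.FiniteType
import Mathlib.RingTheory.RingHom.Finite
import HarnessLib

/-!
# Stub `stub_frobeniusStalkFiniteFlat` for crux stmt-ResolutionOfSingularities-15917
(`RadicialJung.CleanModels`, line `Sketch`, rev 10)

**Frobenius is finite and flat on the local rings of a regular scheme locally of finite type over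
an `F`-finite field** — the standing hypothesis (1.1) of J. Giraud, *Forme normale d'une fonction
sur une surface de caractéristique positive*, Bull. SMF 111 (1983) ("`Ω¹_X` localement libre de
rang fini, ce qui signifie que le morphisme de Frobenius est fini et plat"), which the line's named
fact `Giraud1983Thm24` takes in the form
`∀ x [CharP (𝒪_{X,x}) p], (frobenius 𝒪_{X,x} p).Finite ∧ (frobenius 𝒪_{X,x} p).Flat`.

For `k` a field of characteristic `p` with `IsFFinite p 1 k` (`[k : k^p] < ∞`), `W → Spec k`
locally of finite type, `W` regular and `w ∈ W`:

* FINITE. The stalk `𝒪_{W,w}` is F-finite: it is a localisation of the sections over an affine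
  open neighbourhood, a `k`-algebra of finite type (Kunz 1969, §1: finite type and localisation
  preserve F-finiteness — the tree's `IsFFinite.of_finiteType`, `IsFFinite.of_isLocalization`,
  assembled at stalks as `FRationalModification.TestElement.isFFinite_stalk`); and
  `IsFFinite p 1 O`, i.e. `O = ∑ᵢ O^p sᵢ` for finitely many `sᵢ`, says precisely that `O` is a
  finite module over itself through `frobenius O p` (`finite_frobenius_of_isFFinite`).
* FLAT. `𝒪_{W,w}` is a regular local ring of characteristic `p`, so its Frobenius is flat by
  Kunz's theorem (Kunz 1969, Thm. 2.1; PROVED in tree: `Kunz1969_holds`,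
  `Literature/AlgebraicGeometry/Resolution/KunzRegularityCriterionProofs.lean`).

## References

* [Kunz1969] E. Kunz, *Characterizations of regular local rings of characteristic `p`*, Amer. J.
  Math. 91 (1969) 772–784, §1 and Thm. 2.1.
* [Giraud1983] J. Giraud, Bull. Soc. Math. France 111 (1983) 109–124, 1.1.
-/

noncomputable section

set_option linter.dupNamespace false -- mandated namespace of this single-conjunct summit

open CategoryTheory AlgebraicGeometry TopologicalSpace IsLocalRing
open Literature.AlgebraicGeometry.Resolution

namespace Summit.ResolutionOfSingularities.ResolutionOfSingularities.Theorems.RadicialJung.CleanModels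

/-- **A ring map with a finite generating family is finite.** If finitely many `s₁, …, sₙ ∈ B`
generate `B` over `f : A → B` in the naive sense — every `b ∈ B` is `∑ᵢ f(cᵢ) sᵢ` with `cᵢ ∈ A` —
then `f` is a finite ring homomorphism (`B` is a finitely generated `A`-module through `f`).
[folklore] -/
theorem ringHom_finite_of_forall_exists_eq_sum {A B : Type*} [CommRing A] [CommRing B]
    (f : A →+* B) {n : ℕ} (s : Fin n → B)
    (h : ∀ b : B, ∃ c : Fin n → A, b = ∑ i, f (c i) * s i) : f.Finite := by
  letI : Algebra A B := f.toAlgebra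
  refine Module.Finite.of_fg_top
    (Submodule.fg_iff_exists_fin_generating_family.mpr ⟨n, s, eq_top_iff.mpr fun b _ => ?_⟩)
  obtain ⟨c, rfl⟩ := h b
  refine Submodule.sum_mem _ fun i _ => ?_
  have hi : f (c i) * s i = c i • s i := by
    rw [Algebra.smul_def, RingHom.algebraMap_toAlgebra]
  rw [hi]
  exact Submodule.smul_mem _ _ (Submodule.subset_span (Set.mem_range_self i))

/-- **F-finite rings have finite Frobenius** (Kunz 1969, §1): if `A = ∑ᵢ A^p sᵢ` for finitely
many `sᵢ` (`IsFFinite p 1 A`), then the Frobenius endomorphism `frobenius A p : a ↦ a^p` is a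
finite ring homomorphism — `a = ∑ᵢ cᵢ^p sᵢ = ∑ᵢ F(cᵢ) sᵢ`. [cite: Kunz1969, §1] -/
theorem finite_frobenius_of_isFFinite {p : ℕ} {A : Type*} [CommRing A] [ExpChar A p]
    (h : IsFFinite p 1 A) : (frobenius A p).Finite := by
  obtain ⟨n, s, hs⟩ := h
  refine ringHom_finite_of_forall_exists_eq_sum (frobenius A p) s fun a => ?_
  obtain ⟨c, hc⟩ := hs a
  exact ⟨c, by simpa only [frobenius_def, pow_one] using hc⟩

/-- STUB `stub_frobeniusStalkFiniteFlat` (the standing hypothesis 1.1 of Giraud 1983 for our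
schemes) — **FROBENIUS IS FINITE AND FLAT ON THE LOCAL RINGS of a regular scheme locally of finite
type over an `F`-finite field.** Finite: `k` is `F`-finite (`IsFFinite p 1 k`), hence so is every
finitely generated `k`-algebra (`IsFFinite.of_finiteType`) and every localisation of one
(`IsFFinite.of_isLocalization`), in particular the stalk `𝒪_{W,w}` (a localisation of the sections
of an affine open neighbourhood, `IsAffineOpen.isLocalization_stalk`; tree
`FRationalModification.TestElement.isFFinite_stalk`), and `IsFFinite p 1 O` says precisely that `O`
is a finite module over the image of `frobenius O p` (`finite_frobenius_of_isFFinite`). Flat: the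
stalk is a regular local ring of characteristic `p`, so its Frobenius is flat by Kunz's theorem
(`Kunz1969_holds`, PROVED in tree). [cite: Kunz1969, §1 and Thm. 2.1] -/
theorem stub_frobeniusStalkFiniteFlat (p : ℕ) [Fact p.Prime] (k : Type) [Field k] [CharP k p]
    (hk : IsFFinite p 1 k) (W : Scheme.{0}) (f : W ⟶ Spec (.of k)) [LocallyOfFiniteType f]
    (hW : Scheme.IsRegular W) (w : W) [CharP (W.presheaf.stalk w) p] :
    (frobenius (W.presheaf.stalk w) p).Finite ∧ (frobenius (W.presheaf.stalk w) p).Flat := by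
  haveI : IsRegularLocalRing (W.presheaf.stalk w) := hW w
  exact ⟨finite_frobenius_of_isFFinite (FRationalModification.TestElement.isFFinite_stalk hk f w),
    Kunz1969_holds.flat_frobenius p (W.presheaf.stalk w)⟩

end Summit.ResolutionOfSingularities.ResolutionOfSingularities.Theorems.RadicialJung.CleanModels

end
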